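import Mathlib
import Summits.KontsevichZagierPeriods.Zeta5Search.LaiBoxReflection
import Summits.KontsevichZagierPeriods.Zeta5Search.WellPoisedFaceBoundaryRate
import HarnessLib

/-!
# ζ(5) search — the `decay` field of the κ₃ certificate, SPLIT: Laplace's principle on the sum side, proved;
# uniform Stirling, profile maximum and tail as typed inputs (fam-indep, κ₃ ladder, gen 5)

HONEST FRAMING: systematic search; no irrationality claim unless certified.

OUR work (Summit side; cell `pub-zeta5`, family `indep`, planner seat gen 5, STAGED for the lane). The typed κ₃
certificate `LaiBoxInputs J r M δ m` (tree, p242857) asks for the SUM-SIDE decay rate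
`|C_n · Σ_k R̃_n(k+1)/C_n|^{1/n} → e^{−α}` of Lai's very-well-poised box series. families/indep/DECAY-L1.md §2 proves it
on paper in four steps: (2.1) uniform Stirling `|log R̃_n(ν) − n f(ν/n)| ≤ C log(ν + (M+r)n + 2)` for `ν > rn`, with the
one-variable PROFILE `f`; (2.2/2.3) the shape of `f` (critical points = positive roots of Lai's polynomial `P = L − R`,
kernel-certified unique at the ladder points: tree `LaiBoxUnimodal`, p241620) and `−f(r+x₀) = α̃(x₀)`; (2.4) a tail bound;
and then LAPLACE'S PRINCIPLE for a positive series: `(1/n) log S̃_n → max f`.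

This file PROVES the last step once and for all, against typed inputs:

* `xlnx`, `laiProfile J r M δ` — the profile `f(x) = Σ_j u_j log u_j + x log x − (x−r)log(x−r) + (x+M+r)log(x+M+r) −
  (x+M)log(x+M) − Σ_j [(x+M−δ_j)log(x+M−δ_j) − (x+δ_j)log(x+δ_j)]`, `u_j = M − 2δ_j` (DECAY-L1 §2.1), `continuous_laiProfile`;
* `laiTermR J r M n δ Cn ν = Cn n · laiCore n ν` as a real (the summand; at the ladder `Cn = laiC`, so this is `R̃_n(ν)`);
* `structure LaiDecayInputs J r M δ Cn` — the typed inputs: a point `x₀ > r` where `f` is maximal on `(r, ∞)` (`isMax`;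
  from unimodality), termwise non-negativity, vanishing for `1 ≤ ν ≤ rn`, summability, the two one-sided uniform Stirling
  bounds (`upper`/`lower`, constant `C ≥ 0`; DECAY-L1 Lemma 2.1) and a tail bound beyond `K·n` (`tail`; DECAY-L1 (2.4));
* **`LaiDecayInputs.tendsto_log_tsum_div`** — `(1/n) log Σ_k laiTermR n (k+1) → f(x₀)` (Laplace: `Kn+1` terms of size
  `≤ e^{n f(x₀) + C log(…)}` above, the single term at `ν_n = ⌈x₀ n⌉` below, `f(ν_n/n) → f(x₀)` by continuity);
* **`LaiDecayInputs.decay`** — EXACTLY the `decay` field shape of `LaiBoxInputs` with `C := Cn` and `α := d.alpha :=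
  −f(x₀)`: `Tendsto (fun n => |((Cn n : ℚ) : ℝ) · Σ' k ((laiCore … ((k:ℚ)+1) : ℚ) : ℝ)|^{1/n}) atTop (𝓝 (exp (−d.alpha)))`.

So the LARGE open item 'decay' of families/indep/FAMILY.md §5.13 is now THREE prover-sized typed targets at the ladder
point (uniform Stirling for `R̃_n(ν)` from the tree's `WellPoisedFaceRate.logFactErr_bounds`; `isMax` from `domCheck74` via
`f' = log(L/R)`; the tail from `deg R̃_n ≤ −2`), plus this file. MANUSCRIPT-LEVEL CANDIDATE context only: nothing here
is a margin or dimension statement, and no instance of `LaiDecayInputs` is constructed in this file.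

References: [Lai2024BallRivoal] L. Lai, arXiv:2407.14236, (5.4)–(5.5) p. 17, p. 48–49 (`α̃`); Laplace's principle for
positive series [folklore]; families/indep/DECAY-L1.md §2 (our paper-level proof).
-/

open Finset Filter
open scoped Topology

namespace Summit.KontsevichZagierPeriods.Zeta5Search

open WellPoisedFaceRate (tendsto_log_linear_div)

noncomputable section

/-! ### The profile -/

/-- `y ↦ y log y` (with `0 log 0 = 0`). [folklore] -/
def xlnx (y : ℝ) : ℝ := y * Real.log y

/-- `y log y` is continuous on `ℝ`. [folklore] -/
theorem continuous_xlnx : Continuous xlnx := Real.continuous_mul_log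

/-- The sum-side PROFILE `f` of Lai's box series (DECAY-L1 §2.1): `(1/n) log R̃_n(xn) → f(x)`.
[cite: Lai2024BallRivoal, (5.4)–(5.5)] (our one-variable form) -/
def laiProfile (J r M : ℕ) (δ : Fin J → ℕ) (x : ℝ) : ℝ :=
  (∑ j : Fin J, xlnx ((M : ℝ) - 2 * (δ j : ℝ))) + xlnx x - xlnx (x - r) + xlnx (x + M + r) - xlnx (x + M) -
    ∑ j : Fin J, (xlnx (x + M - δ j) - xlnx (x + δ j))

/-- The profile is continuous. [folklore] -/
theorem continuous_laiProfile (J r M : ℕ) (δ : Fin J → ℕ) : Continuous (laiProfile J r M δ) := by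
  have h : ∀ g : ℝ → ℝ, Continuous g → Continuous fun x => xlnx (g x) := fun g hg => continuous_xlnx.comp hg
  unfold laiProfile
  refine Continuous.sub (Continuous.sub (Continuous.add (Continuous.sub (Continuous.add continuous_const
    continuous_xlnx) (h _ ?_)) (h _ ?_)) (h _ ?_)) (continuous_finsetSum _ fun j _ => (h _ ?_).sub (h _ ?_))
  all_goals fun_prop

/-! ### The summand and the typed inputs -/

/-- The summand of the sum side as a real number: `Cn n · laiCore n ν` (at the ladder `Cn = laiC`, i.e. `R̃_n(ν)`). [this file] -/
def laiTermR (J r M n : ℕ) (δ : Fin J → ℕ) (Cn : ℕ → ℚ) (ν : ℕ) : ℝ :=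
  ((Cn n * laiCore J r M n δ (ν : ℚ) : ℚ) : ℝ)

/-- TYPED INPUTS of the sum-side decay proof (DECAY-L1 §2): the maximiser `x₀ > r` of the profile on `(r, ∞)`,
termwise sign / vanishing / summability, the two one-sided UNIFORM STIRLING bounds with constant `C`, and a tail bound
beyond `K·n`. No instance is constructed here. [this file] -/
structure LaiDecayInputs (J r M : ℕ) (δ : Fin J → ℕ) (Cn : ℕ → ℚ) where
  /-- the maximiser of the profile on `(r, ∞)` (`= r + x₀(Lai)`) -/
  x₀ : ℝ
  r_lt_x₀ : (r : ℝ) < x₀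
  /-- `f ≤ f(x₀)` on `(r, ∞)` (from unimodality: DECAY-L1 Lemma 2.2 + the kernel certificate) -/
  isMax : ∀ x : ℝ, (r : ℝ) < x → laiProfile J r M δ x ≤ laiProfile J r M δ x₀
  /-- termwise non-negativity for `ν ≥ 1` (the summation range) -/
  nonneg : ∀ n ν : ℕ, 1 ≤ ν → 0 ≤ laiTermR J r M n δ Cn ν
  /-- the zeros `1 ≤ ν ≤ rn` -/
  zero : ∀ n ν : ℕ, 1 ≤ ν → ν ≤ r * n → laiTermR J r M n δ Cn ν = 0
  /-- summability of the shifted series -/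
  summable : ∀ n : ℕ, Summable fun k : ℕ => laiTermR J r M n δ Cn (k + 1)
  /-- the uniform Stirling constant -/
  C : ℝ
  C_nonneg : 0 ≤ C
  /-- uniform Stirling, upper half (DECAY-L1 Lemma 2.1) -/
  upper : ∀ n ν : ℕ, 1 ≤ n → r * n < ν →
    laiTermR J r M n δ Cn ν ≤
      Real.exp (n * laiProfile J r M δ ((ν : ℝ) / n) + C * Real.log ((ν : ℝ) + ((M : ℝ) + r) * n + 2))
  /-- uniform Stirling, lower half (DECAY-L1 Lemma 2.1) -/
  lower : ∀ n ν : ℕ, 1 ≤ n → r * n < ν →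
    Real.exp (n * laiProfile J r M δ ((ν : ℝ) / n) - C * Real.log ((ν : ℝ) + ((M : ℝ) + r) * n + 2)) ≤
      laiTermR J r M n δ Cn ν
  /-- the tail cut -/
  K : ℕ
  /-- tail bound beyond `K·n` (DECAY-L1 Prop. 2.4, `deg R̃_n ≤ −2`) -/
  tail : ∀ᶠ n : ℕ in atTop,
    ∑' k : ℕ, laiTermR J r M n δ Cn (k + K * n + 1) ≤ Real.exp (n * laiProfile J r M δ x₀)

namespace LaiDecayInputs

variable {J r M : ℕ} {δ : Fin J → ℕ} {Cn : ℕ → ℚ} (d : LaiDecayInputs J r M δ Cn)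

/-- The decay rate the inputs produce: `α := −f(x₀)` (`= α̃(x₀)`, DECAY-L1 Lemma 2.3). [this file] -/
def alpha : ℝ := -laiProfile J r M δ d.x₀

/-- The field's expression is the shifted series of `laiTermR`. [this file] -/
theorem cast_mul_tsum_eq (n : ℕ) :
    ((Cn n : ℚ) : ℝ) * ∑' k : ℕ, ((laiCore J r M n δ ((k : ℚ) + 1) : ℚ) : ℝ) =
      ∑' k : ℕ, laiTermR J r M n δ Cn (k + 1) := by
  rw [← tsum_mul_left]
  refine tsum_congr fun k => ?_
  simp [laiTermR, Nat.cast_succ]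

include d

/-- The sample index `ν_n = ⌈x₀ n⌉`. [this file] -/
def nu (n : ℕ) : ℕ := ⌈d.x₀ * n⌉₊

/-- `0 < x₀` (since `r < x₀`). -/
theorem x₀_pos : 0 < d.x₀ := lt_of_le_of_lt (Nat.cast_nonneg r) d.r_lt_x₀

/-- `r·n < ν_n` for `n ≥ 1`. -/
theorem rn_lt_nu {n : ℕ} (hn : 1 ≤ n) : r * n < d.nu n := by
  have h1 : (r : ℝ) * n < d.x₀ * n :=
    mul_lt_mul_of_pos_right d.r_lt_x₀ (by exact_mod_cast hn)
  have h2 : d.x₀ * n ≤ (d.nu n : ℝ) := Nat.le_ceil _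
  exact_mod_cast h1.trans_le h2

/-- `1 ≤ ν_n` for `n ≥ 1`. -/
theorem one_le_nu {n : ℕ} (hn : 1 ≤ n) : 1 ≤ d.nu n := by
  have := d.rn_lt_nu hn; omega

/-- `ν_n ≤ x₀·n + 1`. -/
theorem nu_le (n : ℕ) : (d.nu n : ℝ) ≤ d.x₀ * n + 1 :=
  (Nat.ceil_lt_add_one (mul_nonneg d.x₀_pos.le (Nat.cast_nonneg n))).le

/-- `ν_n / n → x₀`. [this file] -/
theorem tendsto_nu_div : Tendsto (fun n : ℕ => (d.nu n : ℝ) / n) atTop (𝓝 d.x₀) := by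
  have hup : Tendsto (fun n : ℕ => d.x₀ + 1 / (n : ℝ)) atTop (𝓝 (d.x₀ + 0)) :=
    tendsto_const_nhds.add tendsto_one_div_atTop_nhds_zero_nat
  rw [add_zero] at hup
  refine tendsto_of_tendsto_of_tendsto_of_le_of_le' tendsto_const_nhds hup ?_ ?_
  · filter_upwards [eventually_ge_atTop 1] with n hn
    have hn' : (0 : ℝ) < n := by exact_mod_cast hn
    rw [le_div_iff₀ hn']
    exact Nat.le_ceil _
  · filter_upwards [eventually_ge_atTop 1] with n hn
    have hn' : (0 : ℝ) < n := by exact_mod_cast hn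
    rw [div_le_iff₀ hn', add_mul, one_div_mul_cancel hn'.ne']
    exact d.nu_le n

/-- A single (non-negative) term is below the sum. [folklore] -/
theorem term_le_tsum (n : ℕ) {ν : ℕ} (hν : 1 ≤ ν) :
    laiTermR J r M n δ Cn ν ≤ ∑' k : ℕ, laiTermR J r M n δ Cn (k + 1) := by
  have h := (d.summable n).sum_le_tsum {ν - 1} (fun k _ => d.nonneg n (k + 1) (Nat.succ_pos k))
  simpa [Nat.sub_add_cancel hν] using h

/-- The sum is positive for `n ≥ 1`. [this file] -/
theorem tsum_pos {n : ℕ} (hn : 1 ≤ n) : 0 < ∑' k : ℕ, laiTermR J r M n δ Cn (k + 1) :=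
  lt_of_lt_of_le (lt_of_lt_of_le (Real.exp_pos _) (d.lower n (d.nu n) hn (d.rn_lt_nu hn)))
    (d.term_le_tsum n (d.one_le_nu hn))

/-- UPPER BOUND (Laplace): `log S_n ≤ log(Kn+1) + n f(x₀) + C log((K+M+r)n+2)` on the tail event. [this file] -/
theorem log_tsum_le {n : ℕ} (hn : 1 ≤ n)
    (htail : ∑' k : ℕ, laiTermR J r M n δ Cn (k + d.K * n + 1) ≤ Real.exp (n * laiProfile J r M δ d.x₀)) :
    Real.log (∑' k : ℕ, laiTermR J r M n δ Cn (k + 1)) ≤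
      Real.log ((d.K : ℝ) * n + 1) + (n * laiProfile J r M δ d.x₀ +
        d.C * Real.log (((d.K : ℝ) + ((M : ℝ) + r)) * n + 2)) := by
  set fs := laiProfile J r M δ d.x₀ with hfs
  set L : ℝ := Real.log (((d.K : ℝ) + ((M : ℝ) + r)) * n + 2) with hL
  set B : ℝ := Real.exp (n * fs + d.C * L) with hB
  have hn' : (0 : ℝ) < n := by exact_mod_cast hn
  have hK0 : (0 : ℝ) ≤ d.K := Nat.cast_nonneg _
  have hM0 : (0 : ℝ) ≤ M := Nat.cast_nonneg _
  have hr0 : (0 : ℝ) ≤ r := Nat.cast_nonneg _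
  have hL0 : 0 ≤ L := Real.log_nonneg (by nlinarith)
  -- each of the first `K n` terms is ≤ B
  have hterm : ∀ k ∈ range (d.K * n), laiTermR J r M n δ Cn (k + 1) ≤ B := by
    intro k hk
    have hkK : k + 1 ≤ d.K * n := mem_range.1 hk
    by_cases hsmall : k + 1 ≤ r * n
    · rw [d.zero n (k + 1) (by omega) hsmall]; exact (Real.exp_pos _).le
    · have hbig : r * n < k + 1 := by omega
      refine (d.upper n (k + 1) hn hbig).trans (Real.exp_le_exp.2 (add_le_add ?_ ?_))
      · refine mul_le_mul_of_nonneg_left (d.isMax _ ?_) hn'.le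
        rw [lt_div_iff₀ hn']; exact_mod_cast hbig
      · refine mul_le_mul_of_nonneg_left (Real.log_le_log (by positivity) ?_) d.C_nonneg
        have : ((k + 1 : ℕ) : ℝ) ≤ (d.K : ℝ) * n := by exact_mod_cast hkK
        push_cast at this ⊢; nlinarith
  have hsplit := (d.summable n).sum_add_tsum_nat_add (d.K * n)
  -- f (i + K n) = laiTermR (i + K n + 1)
  have hS : ∑' k : ℕ, laiTermR J r M n δ Cn (k + 1) ≤ (d.K * n : ℕ) * B + Real.exp (n * fs) := by
    rw [← hsplit]
    refine add_le_add ((sum_le_sum hterm).trans ?_) ?_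
    · rw [sum_const, card_range, nsmul_eq_mul]
    · simpa [add_assoc, add_comm, add_left_comm] using htail
  have hB1 : Real.exp (n * fs) ≤ B := Real.exp_le_exp.2 (by nlinarith [d.C_nonneg])
  have hS' : ∑' k : ℕ, laiTermR J r M n δ Cn (k + 1) ≤ ((d.K : ℝ) * n + 1) * B := by
    have := hS.trans (add_le_add le_rfl hB1); push_cast at this; linarith
  have hpos := d.tsum_pos hn
  calc Real.log (∑' k : ℕ, laiTermR J r M n δ Cn (k + 1))
      ≤ Real.log (((d.K : ℝ) * n + 1) * B) := Real.log_le_log hpos hS'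
    _ = Real.log ((d.K : ℝ) * n + 1) + (n * fs + d.C * L) := by
        rw [Real.log_mul (by positivity) (Real.exp_pos _).ne', Real.log_exp]

/-- LOWER BOUND (Laplace): the single term at `ν_n`. [this file] -/
theorem le_log_tsum {n : ℕ} (hn : 1 ≤ n) :
    n * laiProfile J r M δ ((d.nu n : ℝ) / n) - d.C * Real.log ((d.x₀ + ((M : ℝ) + r)) * n + 3) ≤
      Real.log (∑' k : ℕ, laiTermR J r M n δ Cn (k + 1)) := by
  have hn' : (0 : ℝ) < n := by exact_mod_cast hn
  have h1 := (d.lower n (d.nu n) hn (d.rn_lt_nu hn)).trans (d.term_le_tsum n (d.one_le_nu hn))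
  have h2 := Real.log_le_log (Real.exp_pos _) h1
  rw [Real.log_exp] at h2
  refine le_trans (sub_le_sub_left (mul_le_mul_of_nonneg_left (Real.log_le_log (by positivity) ?_) d.C_nonneg) _) h2
  have := d.nu_le n
  have hM0 : (0 : ℝ) ≤ M := Nat.cast_nonneg _
  have hr0 : (0 : ℝ) ≤ r := Nat.cast_nonneg _
  nlinarith

/-- **LAPLACE'S PRINCIPLE on the sum side**: `(1/n) log Σ_k laiTermR n (k+1) → f(x₀)`. [folklore] (our typed form) -/
theorem tendsto_log_tsum_div :
    Tendsto (fun n : ℕ => Real.log (∑' k : ℕ, laiTermR J r M n δ Cn (k + 1)) / n) atTop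
      (𝓝 (laiProfile J r M δ d.x₀)) := by
  set fs := laiProfile J r M δ d.x₀ with hfs
  -- lower comparison sequence
  have hlow : Tendsto (fun n : ℕ => laiProfile J r M δ ((d.nu n : ℝ) / n) -
      d.C * (Real.log ((d.x₀ + ((M : ℝ) + r)) * n + 3) / n)) atTop (𝓝 (fs - d.C * 0)) := by
    refine (((continuous_laiProfile J r M δ).tendsto d.x₀).comp d.tendsto_nu_div).sub
      ((tendsto_log_linear_div ?_ ?_).const_mul d.C)
    · exact add_nonneg d.x₀_pos.le (by positivity)
    · norm_num
  -- upper comparison sequence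
  have hup : Tendsto (fun n : ℕ => Real.log ((d.K : ℝ) * n + 1) / n + (fs +
      d.C * (Real.log (((d.K : ℝ) + ((M : ℝ) + r)) * n + 2) / n))) atTop (𝓝 (0 + (fs + d.C * 0))) :=
    (tendsto_log_linear_div (by positivity) zero_le_one).add
      (tendsto_const_nhds.add ((tendsto_log_linear_div (by positivity) zero_le_two).const_mul d.C))
  simp only [mul_zero, sub_zero, zero_add, add_zero] at hlow hup
  refine tendsto_of_tendsto_of_tendsto_of_le_of_le' hlow hup ?_ ?_
  · filter_upwards [eventually_ge_atTop 1] with n hn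
    have hn' : (0 : ℝ) < n := by exact_mod_cast hn
    rw [le_div_iff₀ hn']
    have := d.le_log_tsum hn
    have e : (laiProfile J r M δ ((d.nu n : ℝ) / n) - d.C * (Real.log ((d.x₀ + ((M : ℝ) + r)) * n + 3) / n)) * n =
        n * laiProfile J r M δ ((d.nu n : ℝ) / n) - d.C * Real.log ((d.x₀ + ((M : ℝ) + r)) * n + 3) := by
      field_simp
    linarith
  · filter_upwards [eventually_ge_atTop 1, d.tail] with n hn htail
    have hn' : (0 : ℝ) < n := by exact_mod_cast hn
    rw [div_le_iff₀ hn']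
    have := d.log_tsum_le hn htail
    have e : (Real.log ((d.K : ℝ) * n + 1) / n + (fs + d.C * (Real.log (((d.K : ℝ) + ((M : ℝ) + r)) * n + 2) / n))) * n
        = Real.log ((d.K : ℝ) * n + 1) + (n * fs + d.C * Real.log (((d.K : ℝ) + ((M : ℝ) + r)) * n + 2)) := by
      field_simp
    linarith

/-- **THE `decay` FIELD** of `LaiBoxInputs` (with `C := Cn`, `α := d.alpha = −f(x₀)`), from the typed inputs:
`|Cn n · Σ' k laiCore n (k+1)|^{1/n} → e^{−α}`. [this file] -/
theorem decay :
    Tendsto (fun n : ℕ =>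
      |((Cn n : ℚ) : ℝ) * ∑' k : ℕ, ((laiCore J r M n δ ((k : ℚ) + 1) : ℚ) : ℝ)| ^ ((1 : ℝ) / n))
      atTop (𝓝 (Real.exp (-d.alpha))) := by
  have hmain := (Real.continuous_exp.tendsto _).comp d.tendsto_log_tsum_div
  rw [alpha, neg_neg]
  refine hmain.congr' ?_
  filter_upwards [eventually_ge_atTop 1] with n hn
  have hpos := d.tsum_pos hn
  rw [Function.comp_apply, cast_mul_tsum_eq, abs_of_pos hpos, Real.rpow_def_of_pos hpos, div_eq_mul_one_div]

end LaiDecayInputs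

end

end Summit.KontsevichZagierPeriods.Zeta5Search
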